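import Summits.Ventures.QEC.Census.CertCoverBatch
import Summits.Ventures.QEC.Census.BB.A1s_n180_k8_51b6db11.CoreDefs
import HarnessLib

set_option Elab.async false
set_option maxRecDepth 200000

/-!
# `[[180,8,16]]` one-level cover certificate of `A1s_n180_k8_51b6db11` — LEVEL-1→0 coset problems 181…206 (deep problems [46] excluded: `ProbDeep*.lean`) as COMPACT data
(`ProbData`: U, f, σ, y₀, allow; qec-type-10 `CertCoverBatch.mkCoset` rebuilds each `CosetProb` in the kernel) + their verdict
`probsOK cov covR hx hx1 D1 lxd 14` (one `decide +kernel`; 26 problems, depths f=0:19 f=1:7 f=2:0 f=3:0, est. 122.5 s).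
qec-search-1 g5 (pattern of search-9 g5 `Probs*`); data from JSON `level10.problems` (sha256 cdf2fcfc3865e75f…). Data + decided check; KERNEL.
-/

namespace Summit.Ventures.QEC.Census.A1s_n180_k8_51b6db11

open Matrix Summit.Ventures.QEC.Census Literature.InformationTheory.QuantumCodes

/-- Problems 181…206 (26): `⟨U, f, σ, y₀, allow⟩`. -/
def probs04a : List ProbData := [
    ⟨191108282220292459266048, 0, 8803672129923, 191108282220034493292560, []⟩,
    ⟨191257013632861236092929, 1, 26392372707844, 2361201396570820567040, [0]⟩,
    ⟨191329631925173030715392, 1, 2216689732, 40213904473275664269312, [0]⟩,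
    ⟨192439947195754160988162, 0, 26391869425158, 40143574009643293245443, []⟩,
    ⟨192657802072483386490880, 0, 17593366741190, 2508761838395974516736, []⟩,
    ⟨195424811783626139242496, 0, 4399171633296, 42538196337630845767685, []⟩,
    ⟨214277394359996333056000, 0, 26389805793712, 43681889966567882565890, []⟩,
    ⟨264460719592021946277893, 1, 8798509010432, 113340326410979343597568, [0, 2, 16384]⟩,
    ⟨264533337884333740933124, 0, 17595946306624, 151120375166712812683269, []⟩,
    ⟨264678574468751171780615, 0, 6392000, 226825781319985061167108, []⟩,
    ⟨264751192761269124866050, 0, 8801738589952, 264751138717798718504963, []⟩,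
    ⟨264896429345480397316097, 0, 26395539407744, 189337412697803806827650, []⟩,
    ⟨265049844501662713036804, 0, 8798794222593, 151710671012187976253445, []⟩,
    ⟨266228094320942099005447, 0, 8798290937859, 152891226674476575916036, []⟩,
    ⟨266817219230581792153602, 0, 8798576084484, 264455981805213952638979, []⟩,
    ⟨267035074107311017656320, 0, 73400516, 78066625564310298001408, []⟩,
    ⟨267995469049862251765761, 0, 8799146476038, 152296337157313848860672, []⟩,
    ⟨268068087342174046388224, 0, 17595510030406, 190149040234018692562944, []⟩,
    ⟨279800226917412797194240, 0, 8802703245676, 270355484662728700823808, []⟩,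
    ⟨340020925189742502371343, 1, 26395527025152, 37780228899649844412423, [0]⟩,
    ⟨340093543482054296993806, 1, 7518490688, 340093399366797501661192, [0]⟩,
    ⟨340751755827401017270274, 0, 8808193623168, 302821786743087896207361, []⟩,
    ⟨340901676155087316082694, 0, 26405215766784, 302821822771747476234243, []⟩,
    ⟨344733924466862194122753, 1, 26395661042184, 42502451548806390677505, [0]⟩,
    ⟨349750271226545747402752, 0, 26393656164454, 47518814985841027494467, []⟩,
    ⟨415581130787463058432012, 1, 8803877885440, 302240732318889676906505, [1, 16384]⟩]

set_option maxHeartbeats 400000000 in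
/-- Every problem of this chunk passes (`mkCoset` elimination + `cosetOKD` + fast `σ` + depth + `BU`-evenness + label checks). -/
theorem probs04a_ok : probsOK A1s_n180_k8_51b6db11.cov covR hx hx1 D1 lxd 14 probs04a = true := by
  decide +kernel

/-- Pointwise form. -/
theorem probs04a_all : ∀ x ∈ probs04a, probOK A1s_n180_k8_51b6db11.cov covR hx hx1 D1 lxd 14 x = true := by
  have h := probs04a_ok
  rwa [probsOK, List.all_eq_true] at h

end Summit.Ventures.QEC.Census.A1s_n180_k8_51b6db11
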